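import Summits.QuantumFields.YangMills.Theorems.UnitScaleTiltProp7ChainPotentialHessianRow
import Summits.QuantumFields.YangMills.Theorems.UnitScaleTiltProp7GradientRowOfPcol
import Summits.QuantumFields.YangMills.Theorems.UnitScaleTiltProp7GaugeProjectorSupPackageMember
import HarnessLib

/-!
# Route `UnitScaleTilt`, crux K1 «MinimiserStabilityRegPr» (stmt-QuantumFields-19200), EX face, norm_G road rows (5)∕(6), family level:
# **THE (H∇)-FAMILY ∃-PACKAGE** — the (∇1)-KNIT's chain-potential Hessian letter `hHD` AT EVERY MEMBER OF EVERY FAMILY, ITS THREE ROUTE LETTERS DISCHARGED —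
# **and the unweighted (c1)∕(c2)∕(c3) SUP LETTERS of FILE C ∕ (O-G1) ∕ (∇1) as L-only ∃-packages**

The (∇1)-KNIT ✓`Prop7GreenOneGradientRowOfLetters.gradient_row_GTone_of_letters` (and its (H1∇) edition ✓`Prop7H1GradientRowOfLetters`) reads
ONE second-order letter, the (115)-gradient sup row of the chain potential
`hHD : ∀ v m, (∀ x, ‖v x‖ ≤ m) → ‖∇^η_{(115)}(toL2⁻¹(D_{U₀}(G′ᴾ_{a′}(R_S(G′ᴾ_{a′}(toL2S v))))) ∘ bondEquiv⁻¹)‖ ≤ BH·m`,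
besides the first-order sup letters (c1) `‖toL2S⁻¹(G′ᴾR_S(toL2S w))‖_∞ ≤ C₁m′`, (c2) `‖toL2⁻¹(D G′ᴾR_S(toL2S w))‖_∞ ≤ C₂m′`, (c3) `‖toL2S⁻¹(R_S G′ᴾ(toL2S w))‖_∞ ≤ C₃m′`.
✓`Prop7ChainPotentialHessianRow.hessRow_chain_of_letters` typed `hHD` at one member from HESS-T1 ✓`norm_covGradT_DL2_le_DeltaEtaSlot` and the letters
(c1), (c3), (Dg) `‖toL2⁻¹(D R_S G′ᴾ(toL2S w))‖_∞ ≤ C_{Dg}m′`.  All of them are LANDED for every member under the face's Lift antecedent: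
(c1)∕(c2)∕(c3) = px5's ✓`Prop7GaugeProjectorSupPackageMember.norm_symm_{GprimeP_RS,DL2_GprimeP_RS,RS_GprimeP}_toL2S_le_member_of_lift` (LOD data of record
discharged from `RegPr`, member-free constants at LOD mass `am`), (Dg) = ✓`Prop7GradientRowOfPcol.gradRow_RS_GprimeP_allMembers_exists` (converse column∕row
duality over ✓`hPcol_allMembers_exists`).

This file packages them GΠ-PKG-style (✓`Prop7GreenPiBlockFamilyPackage.hGblk_pi_family_exists`'s `∃`-head), at ONE regularity scale of record
`αH L := min (10⁻¹²L⁻³) (1∕(2(C_g+1)·48(6√2√10+6√2)))` (= ✓`hPcol_allMembers_exists`'s `αP` verbatim, so HESS-T1's small-field window holds; §1), LOD mass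
pinned at `am := 1`, `G′ᴾ`'s parameter the FREE display coupling `0 ≤ a′`, every constant L-ONLY (K-free by construction — each constituent is member-free):
* §2 ★★`hc1_hc3_sup_family : ∃ C₁ C₃ : ℕ → ℝ, 0 ≤ C₁ L ∧ 0 ≤ C₃ L ∧ ∀ L > 1, ∀ i U₀ ρ, RegPr ρ U₀ → ρ ≤ αH L → Lift → ∀ a′ ≥ 0, ⟨(c1) ∧ (c3)⟩`;
* §3 ★★`hc2_sup_family : ∃ C₂ : ℕ → ℝ, 0 ≤ C₂ L ∧ ∀ L > 1, … → Lift → room → ∀ a′ ≥ 0, ⟨(c2)⟩` (the (c2) member row carries HESS∕T1's no-wrap ROOM);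
* §4 ★★★`hessRow_chain_family : ∃ (αH′ BH : ℕ → ℝ), 0 < αH′ L ∧ 10¹²L³·αH′ L ≤ 1 ∧ 0 ≤ BH L ∧ ∀ L > 1, ∀ i U₀ ρ, RegPr ρ U₀ → ρ ≤ αH′ L → Lift → room →
  ∀ a′ ≥ 0, ⟨the hHD letter at BH L⟩` (`αH′ := min αH αP`, `αP` the (Dg) package's scale).
The closed constants are assembled by the kernel: each `∃`-witness is obtained by unification from the member rows (the statements never spell the
multi-kchar closed forms); the signs by `positivity` on the assembled terms.  Displayed, exactly as GΠ-PKG displays them: `RegPr`, the face's Lift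
antecedent, HESS-T1's no-wrap ROOM `2(12L^{K−n}+5) ≤ |T|`.

px17 g12 (prover-ym3-torus-px17-g12-0), for ★p1 g28 WORD №43 (4) «GO (P1) (H∇)-FAMILY».  Def-free; no `sorry`; 0 `maxHeartbeats` overrides (every declaration elaborates under 100 k heartbeats).
HONEST: a packaging of landed member rows; STOREY H ((Hess3) `h3`), `h88`, EX, 19200 NOT proved here; rung R3 = SU(2) YM₃ on T³ — NOT d = 4,
NOT infinite volume, NOT a mass gap, NOT Clay.
-/

set_option autoImplicit false

noncomputable section

open scoped BigOperators Matrix.Norms.L2Operator InnerProductSpace ComplexConjugate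

namespace Summit.QuantumFields.YangMills.Theorems.Prop7ChainPotentialHessianFamily

open Literature.MathematicalPhysics.QuantumFieldTheory.Balaban1983to89
open Literature.MathematicalPhysics.QuantumFieldTheory.Balaban1983to89.T3ContinuumYM3Torus
open Literature.MathematicalPhysics.QuantumFieldTheory.Balaban1983to89.T3PrintedRegularMinimiser (RegPr)
open Literature.MathematicalPhysics.QuantumFieldTheory.Balaban1983to89.T3PrintedMinimiserExistence (regPr_mono)
open B15DeterminingSets (embIter)
open T3SectALandauChart (bgUnits)
open B9SectCLatticeCarrier (Bond)
open B11Eq111FrakG (nabla115)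
open Summit.QuantumFields.YangMills.Theorems.Prop8Chart (emlIterU)
open Summit.QuantumFields.YangMills.Theorems.Prop7SectET3Transport (periodsT3 bondEquiv bgOfCfg)
open Summit.QuantumFields.YangMills.Theorems.Prop7SectET3HilbertLetters (W₂ toL2 toL2S DL2 DstarL2)
open Summit.QuantumFields.YangMills.Theorems.Prop7SectET3GaugeProjector (RS)
open Summit.QuantumFields.YangMills.Theorems.Prop7SectET3DeltaPiPInv (GprimeP)
open Summit.QuantumFields.YangMills.Theorems.Prop7CurvedMemberLocalGradient (exists_curved_localGradient)
open Summit.QuantumFields.YangMills.Theorems.AxialGaugeChartGlue (norm_bgOfCfg_axialT_sub_le)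
open Summit.QuantumFields.YangMills.Theorems.Prop7ChainPotentialHessianRow (hessRow_chain_of_letters)
open Summit.QuantumFields.YangMills.Theorems.Prop7GradientRowOfPcol (gradRow_RS_GprimeP_allMembers_exists)
open Summit.QuantumFields.YangMills.Theorems.Prop7GaugeProjectorSupPackageMember
  (norm_symm_GprimeP_RS_toL2S_le_member_of_lift norm_symm_DL2_GprimeP_RS_toL2S_le_member_of_lift norm_symm_RS_GprimeP_toL2S_le_member_of_lift)

/-! ## §1 The regularity scale `αH` of record and its windows -/

/-- The regularity scale of record `αH L := min (10⁻¹²L⁻³) (1∕(2(C_g+1)·48(6√2√10+6√2)))` (✓`hPcol_allMembers_exists`'s `αP`) is positive.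
[cite: Balaban1985Variational, (2) p.278, (138)–(139) p.299] -/
theorem alphaH_pos (L : ℕ) (hL : 1 < L) : 0 < min (1 / (10 ^ 12 * (L : ℝ) ^ 3)) (1 / (2 * ((exists_curved_localGradient.choose + 1) * (48 * (6 * Real.sqrt 2 * Real.sqrt 10 + 6 * Real.sqrt 2))))) := by
  have hCg0 : 0 ≤ exists_curved_localGradient.choose := exists_curved_localGradient.choose_spec.1
  have hL0 : (0:ℝ) < L := by exact_mod_cast (by omega : 0 < L)
  exact lt_min (by positivity) (by positivity)

/-- Every `α ≤ αH L` is inside the `10¹²L³` window, at most `1`, and inside HESS-T1's small-field window `C_g·(48α)(6√2√10+6√2) ≤ 1∕2`.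
[cite: Balaban1985Variational, (2) p.278, (138)–(139) p.299; Balaban1985BackgroundPropagators, Thm 3.1 (3.42) p.397] -/
theorem alphaH_windows (L : ℕ) (hL : 1 < L) {α : ℝ} (hα : α ≤ min (1 / (10 ^ 12 * (L : ℝ) ^ 3)) (1 / (2 * ((exists_curved_localGradient.choose + 1) * (48 * (6 * Real.sqrt 2 * Real.sqrt 10 + 6 * Real.sqrt 2)))))) :
    10 ^ 12 * (L : ℝ) ^ 3 * α ≤ 1 ∧ α ≤ 1 ∧ exists_curved_localGradient.choose * ((48 * α) * (6 * Real.sqrt 2 * Real.sqrt 10 + 6 * Real.sqrt 2)) ≤ 1 / 2 := by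
  have hCg0 : 0 ≤ exists_curved_localGradient.choose := exists_curved_localGradient.choose_spec.1
  have hL0 : (0:ℝ) < L := by exact_mod_cast (by omega : 0 < L)
  have hL1 : (1:ℝ) ≤ L := by exact_mod_cast hL.le
  have hT0 : (0:ℝ) < (6 * Real.sqrt 2 * Real.sqrt 10 + 6 * Real.sqrt 2) := by positivity
  have hP0 : (0:ℝ) < 10 ^ 12 * (L : ℝ) ^ 3 := by positivity
  have hP1 : (1:ℝ) ≤ 10 ^ 12 * (L : ℝ) ^ 3 := by
    have : (1:ℝ) ≤ (L : ℝ) ^ 3 := one_le_pow₀ hL1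
    nlinarith
  generalize hT : ((6 * Real.sqrt 2 * Real.sqrt 10 + 6 * Real.sqrt 2) : ℝ) = T at hT0 hα ⊢
  generalize hC : exists_curved_localGradient.choose = C at hCg0 hα ⊢
  generalize hP : (10 : ℝ) ^ 12 * (L : ℝ) ^ 3 = P at hP0 hP1 hα ⊢
  have h1 : α ≤ 1 / P := hα.trans (min_le_left _ _)
  have h2 : α ≤ 1 / (2 * ((C + 1) * (48 * T))) := hα.trans (min_le_right _ _)
  refine ⟨?_, ?_, ?_⟩
  · calc P * α ≤ P * (1 / P) := mul_le_mul_of_nonneg_left h1 hP0.le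
      _ = 1 := by field_simp
  · exact h1.trans (by rw [div_le_one hP0]; exact hP1)
  · calc C * ((48 * α) * T) = (C * (48 * T)) * α := by ring
      _ ≤ (C * (48 * T)) * (1 / (2 * ((C + 1) * (48 * T)))) := mul_le_mul_of_nonneg_left h2 (by positivity)
      _ = C / (2 * (C + 1)) := by field_simp
      _ ≤ 1 / 2 := by rw [div_le_div_iff₀ (by positivity) (by norm_num)]; nlinarith

/-- At a member `i : Idx L` (so `i.1.1.L = L`) the window reads `10¹²·(i.1.1.L)³·α ≤ 1` for every `α ≤ αH L`. -/
theorem alphaH_window_member (L : ℕ) (hL : 1 < L) (i : T3Thm1Carrier.Idx L) {α : ℝ} (hα : α ≤ min (1 / (10 ^ 12 * (L : ℝ) ^ 3)) (1 / (2 * ((exists_curved_localGradient.choose + 1) * (48 * (6 * Real.sqrt 2 * Real.sqrt 10 + 6 * Real.sqrt 2)))))) :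
    10 ^ 12 * (i.1.1.L : ℝ) ^ 3 * α ≤ 1 := by
  rw [show (i.1.1.L : ℝ) = (L : ℝ) by exact_mod_cast i.2.1]; exact (alphaH_windows L hL hα).1

/-! ## §2 ★★ The (c1)∕(c3) sup letters for every member of every family, `C₁ C₃` ∃-packaged -/

/-- ★★ **FILE C's UNWEIGHTED (c1) AND (c3) SUP LETTERS FOR EVERY MEMBER OF EVERY FAMILY, L-ONLY CONSTANTS `0 ≤ C₁ L`, `0 ≤ C₃ L`** — under `RegPr ρ U₀`,
`ρ ≤ αH L` and the face's Lift antecedent, for every display coupling `0 ≤ a′`: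
`∀ w m′, (∀ x, ‖w x‖ ≤ m′) → (∀ x, ‖toL2S⁻¹(G′ᴾ_{a′}(R_S(toL2S w))) x‖ ≤ C₁ L·m′) ∧ (∀ x, ‖toL2S⁻¹(R_S(G′ᴾ_{a′}(toL2S w))) x‖ ≤ C₃ L·m′)`.
PROOF: px5's ✓`norm_symm_GprimeP_RS_toL2S_le_member_of_lift` ∕ ✓`norm_symm_RS_GprimeP_toL2S_le_member_of_lift` at LOD mass `am := 1` and
`ε₀ := αH L` (`RegPr ρ → RegPr (αH L)` by ✓`regPr_mono`, the `10¹²L³` window by §1); the witnesses by unification, the signs by `positivity`.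
[cite: Balaban1985BackgroundPropagators, (3.20)–(3.25) p.394, Thm 3.1 (3.42)∕(3.46) pp.397–398, (3.49) p.399, (3.114)–(3.122) pp.418–420; Balaban1985Variational, (138)–(139) p.299] -/
theorem hc1_hc3_sup_family (c₀ cB : ℕ → ℝ) [hc₀ : ∀ L : ℕ, Fact (0 < c₀ L)] [hcB : ∀ L : ℕ, Fact (0 < cB L)] :
    ∃ (C₁ C₃ : ℕ → ℝ), (∀ L : ℕ, 1 < L → 0 ≤ C₁ L) ∧ (∀ L : ℕ, 1 < L → 0 ≤ C₃ L) ∧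
      ∀ (L : ℕ), 1 < L → ∀ (i : T3Thm1Carrier.Idx L) (U₀ : GaugeField (i.1.1.P i.1.2.2) 0 (Matrix.specialUnitaryGroup (Fin 2) ℂ)), ∀ ρ : ℝ, RegPr i.1.1 i.1.2.1 i.1.2.2 ρ U₀ →
        ρ ≤ min (1 / (10 ^ 12 * (L : ℝ) ^ 3)) (1 / (2 * ((exists_curved_localGradient.choose + 1) * (48 * (6 * Real.sqrt 2 * Real.sqrt 10 + 6 * Real.sqrt 2))))) →
        (∀ cf : Site (i.1.1.P i.1.2.2) (i.1.2.2 - i.1.2.1) → Matrix (Fin 2) (Fin 2) ℂ,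
        (∀ e' : PBond (i.1.1.P i.1.2.2) (i.1.2.2 - i.1.2.1), cf e'.src = ((emlIterU (i.1.2.2 - i.1.2.1) (bgUnits i.1.1 i.1.2.2 U₀) e' : (Matrix (Fin 2) (Fin 2) ℂ)ˣ) : Matrix (Fin 2) (Fin 2) ℂ) * cf e'.tgt *
        (((emlIterU (i.1.2.2 - i.1.2.1) (bgUnits i.1.1 i.1.2.2 U₀) e')⁻¹ : (Matrix (Fin 2) (Fin 2) ℂ)ˣ) : Matrix (Fin 2) (Fin 2) ℂ)) →
        ∃ l₀ : Site (i.1.1.P i.1.2.2) 0 → Matrix (Fin 2) (Fin 2) ℂ,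
        (∀ b' : PBond (i.1.1.P i.1.2.2) 0, l₀ b'.src = ((bgUnits i.1.1 i.1.2.2 U₀ b' : (Matrix (Fin 2) (Fin 2) ℂ)ˣ) : Matrix (Fin 2) (Fin 2) ℂ) * l₀ b'.tgt * (((bgUnits i.1.1 i.1.2.2 U₀ b')⁻¹ : (Matrix (Fin 2) (Fin 2) ℂ)ˣ) : Matrix (Fin 2) (Fin 2) ℂ)) ∧
        ∀ y : Site (i.1.1.P i.1.2.2) (i.1.2.2 - i.1.2.1), l₀ (embIter (i.1.2.2 - i.1.2.1) y) = cf y) →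
      ∀ a' : ℝ, 0 ≤ a' → ∀ (w : Site (i.1.1.P i.1.2.2) 0 → Matrix (Fin 2) (Fin 2) ℂ) (m' : ℝ), (∀ x, ‖w x‖ ≤ m') →
        (∀ x : Site (i.1.1.P i.1.2.2) 0,
          ‖(toL2S i.1.1 i.1.2.2 (c₀ L)).symm (GprimeP i.1.1 i.1.2.1 i.1.2.2 i.2.2.le (c₀ L) (cB L) a' U₀ (RS i.1.1 i.1.2.1 i.1.2.2 i.2.2.le (c₀ L) (cB L) U₀
            (toL2S i.1.1 i.1.2.2 (c₀ L) w))) x‖ ≤ C₁ L * m') ∧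
        (∀ x : Site (i.1.1.P i.1.2.2) 0,
          ‖(toL2S i.1.1 i.1.2.2 (c₀ L)).symm (RS i.1.1 i.1.2.1 i.1.2.2 i.2.2.le (c₀ L) (cB L) U₀ (GprimeP i.1.1 i.1.2.1 i.1.2.2 i.2.2.le (c₀ L) (cB L) a' U₀
            (toL2S i.1.1 i.1.2.2 (c₀ L) w))) x‖ ≤ C₃ L * m') := by
  -- rows FIRST (their proofs assemble `C₁ C₃` by unification), signs SECOND (positivity on the assembled constants)
  have key : ∃ (C₁ C₃ : ℕ → ℝ), (∀ (L : ℕ), 1 < L → ∀ (i : T3Thm1Carrier.Idx L) (U₀ : GaugeField (i.1.1.P i.1.2.2) 0 (Matrix.specialUnitaryGroup (Fin 2) ℂ)), ∀ ρ : ℝ, RegPr i.1.1 i.1.2.1 i.1.2.2 ρ U₀ →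
        ρ ≤ min (1 / (10 ^ 12 * (L : ℝ) ^ 3)) (1 / (2 * ((exists_curved_localGradient.choose + 1) * (48 * (6 * Real.sqrt 2 * Real.sqrt 10 + 6 * Real.sqrt 2))))) →
        (∀ cf : Site (i.1.1.P i.1.2.2) (i.1.2.2 - i.1.2.1) → Matrix (Fin 2) (Fin 2) ℂ,
        (∀ e' : PBond (i.1.1.P i.1.2.2) (i.1.2.2 - i.1.2.1), cf e'.src = ((emlIterU (i.1.2.2 - i.1.2.1) (bgUnits i.1.1 i.1.2.2 U₀) e' : (Matrix (Fin 2) (Fin 2) ℂ)ˣ) : Matrix (Fin 2) (Fin 2) ℂ) * cf e'.tgt *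
        (((emlIterU (i.1.2.2 - i.1.2.1) (bgUnits i.1.1 i.1.2.2 U₀) e')⁻¹ : (Matrix (Fin 2) (Fin 2) ℂ)ˣ) : Matrix (Fin 2) (Fin 2) ℂ)) →
        ∃ l₀ : Site (i.1.1.P i.1.2.2) 0 → Matrix (Fin 2) (Fin 2) ℂ,
        (∀ b' : PBond (i.1.1.P i.1.2.2) 0, l₀ b'.src = ((bgUnits i.1.1 i.1.2.2 U₀ b' : (Matrix (Fin 2) (Fin 2) ℂ)ˣ) : Matrix (Fin 2) (Fin 2) ℂ) * l₀ b'.tgt * (((bgUnits i.1.1 i.1.2.2 U₀ b')⁻¹ : (Matrix (Fin 2) (Fin 2) ℂ)ˣ) : Matrix (Fin 2) (Fin 2) ℂ)) ∧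
        ∀ y : Site (i.1.1.P i.1.2.2) (i.1.2.2 - i.1.2.1), l₀ (embIter (i.1.2.2 - i.1.2.1) y) = cf y) →
      ∀ a' : ℝ, 0 ≤ a' → ∀ (w : Site (i.1.1.P i.1.2.2) 0 → Matrix (Fin 2) (Fin 2) ℂ) (m' : ℝ), (∀ x, ‖w x‖ ≤ m') →
        (∀ x : Site (i.1.1.P i.1.2.2) 0,
          ‖(toL2S i.1.1 i.1.2.2 (c₀ L)).symm (GprimeP i.1.1 i.1.2.1 i.1.2.2 i.2.2.le (c₀ L) (cB L) a' U₀ (RS i.1.1 i.1.2.1 i.1.2.2 i.2.2.le (c₀ L) (cB L) U₀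
            (toL2S i.1.1 i.1.2.2 (c₀ L) w))) x‖ ≤ C₁ L * m') ∧
        (∀ x : Site (i.1.1.P i.1.2.2) 0,
          ‖(toL2S i.1.1 i.1.2.2 (c₀ L)).symm (RS i.1.1 i.1.2.1 i.1.2.2 i.2.2.le (c₀ L) (cB L) U₀ (GprimeP i.1.1 i.1.2.1 i.1.2.2 i.2.2.le (c₀ L) (cB L) a' U₀
            (toL2S i.1.1 i.1.2.2 (c₀ L) w))) x‖ ≤ C₃ L * m')) ∧
      (∀ L : ℕ, 1 < L → 0 ≤ C₁ L) ∧ (∀ L : ℕ, 1 < L → 0 ≤ C₃ L) :=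
    ⟨_, _, fun L hL i U₀ ρ hρ hρα hLift a' ha' w m' hw =>
      ⟨fun x => norm_symm_GprimeP_RS_toL2S_le_member_of_lift i.1.1 i.2.2.le (c₀ := c₀ L) (cB := cB L) (alphaH_pos L hL) U₀ (regPr_mono i.1.1 hρα hρ) i.2.2
          (alphaH_window_member L hL i le_rfl) one_pos hLift ha' w hw x,
       fun x => norm_symm_RS_GprimeP_toL2S_le_member_of_lift i.1.1 i.2.2.le (c₀ := c₀ L) (cB := cB L) (alphaH_pos L hL) U₀ (regPr_mono i.1.1 hρα hρ) i.2.2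
          (alphaH_window_member L hL i le_rfl) one_pos hLift ha' w hw x⟩,
      fun L hL => by
        have hM2 : (2:ℝ) ≤ max 2 (16 / (1:ℝ)) := le_max_left _ _
        have hsM : 0 < Real.sqrt (max 2 (16 / (1:ℝ))) := Real.sqrt_pos.2 (by linarith)
        positivity,
      fun L hL => by
        have hM2 : (2:ℝ) ≤ max 2 (16 / (1:ℝ)) := le_max_left _ _
        have hsM : 0 < Real.sqrt (max 2 (16 / (1:ℝ))) := Real.sqrt_pos.2 (by linarith)
        positivity⟩
  obtain ⟨C₁, C₃, hrows, h₁, h₃⟩ := key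
  exact ⟨C₁, C₃, h₁, h₃, hrows⟩

/-! ## §3 ★★ The (c2) sup letter for every ROOMY member of every family, `C₂` ∃-packaged -/

/-- ★★ **FILE C's UNWEIGHTED (c2) SUP LETTER FOR EVERY ROOMY MEMBER OF EVERY FAMILY, L-ONLY CONSTANT `0 ≤ C₂ L`** — under `RegPr ρ U₀`, `ρ ≤ αH L`, the
face's Lift antecedent and the no-wrap room `2(12L^{K−n}+5) ≤ |T|`, for every display coupling `0 ≤ a′`:
`∀ w m′, (∀ x, ‖w x‖ ≤ m′) → ∀ b, ‖toL2⁻¹(D_{U₀}(G′ᴾ_{a′}(R_S(toL2S w)))) b‖ ≤ C₂ L·m′`.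
PROOF: px5's ✓`norm_symm_DL2_GprimeP_RS_toL2S_le_member_of_lift` at `am := 1`, `ε₀ := αH L` (HESS∕T1's `hsmall` by §1); witness by unification, sign by `positivity`.
[cite: Balaban1985BackgroundPropagators, (3.20)–(3.25) p.394, Thm 3.1 (3.42)∕(3.46) pp.397–398, (3.49) p.399, (3.114)–(3.122) pp.418–420; Balaban1985Variational, (138)–(139) p.299] -/
theorem hc2_sup_family (c₀ cB : ℕ → ℝ) [hc₀ : ∀ L : ℕ, Fact (0 < c₀ L)] [hcB : ∀ L : ℕ, Fact (0 < cB L)] :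
    ∃ C₂ : ℕ → ℝ, (∀ L : ℕ, 1 < L → 0 ≤ C₂ L) ∧
      ∀ (L : ℕ), 1 < L → ∀ (i : T3Thm1Carrier.Idx L) (U₀ : GaugeField (i.1.1.P i.1.2.2) 0 (Matrix.specialUnitaryGroup (Fin 2) ℂ)), ∀ ρ : ℝ, RegPr i.1.1 i.1.2.1 i.1.2.2 ρ U₀ →
        ρ ≤ min (1 / (10 ^ 12 * (L : ℝ) ^ 3)) (1 / (2 * ((exists_curved_localGradient.choose + 1) * (48 * (6 * Real.sqrt 2 * Real.sqrt 10 + 6 * Real.sqrt 2))))) →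
        (∀ cf : Site (i.1.1.P i.1.2.2) (i.1.2.2 - i.1.2.1) → Matrix (Fin 2) (Fin 2) ℂ,
        (∀ e' : PBond (i.1.1.P i.1.2.2) (i.1.2.2 - i.1.2.1), cf e'.src = ((emlIterU (i.1.2.2 - i.1.2.1) (bgUnits i.1.1 i.1.2.2 U₀) e' : (Matrix (Fin 2) (Fin 2) ℂ)ˣ) : Matrix (Fin 2) (Fin 2) ℂ) * cf e'.tgt *
        (((emlIterU (i.1.2.2 - i.1.2.1) (bgUnits i.1.1 i.1.2.2 U₀) e')⁻¹ : (Matrix (Fin 2) (Fin 2) ℂ)ˣ) : Matrix (Fin 2) (Fin 2) ℂ)) →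
        ∃ l₀ : Site (i.1.1.P i.1.2.2) 0 → Matrix (Fin 2) (Fin 2) ℂ,
        (∀ b' : PBond (i.1.1.P i.1.2.2) 0, l₀ b'.src = ((bgUnits i.1.1 i.1.2.2 U₀ b' : (Matrix (Fin 2) (Fin 2) ℂ)ˣ) : Matrix (Fin 2) (Fin 2) ℂ) * l₀ b'.tgt * (((bgUnits i.1.1 i.1.2.2 U₀ b')⁻¹ : (Matrix (Fin 2) (Fin 2) ℂ)ˣ) : Matrix (Fin 2) (Fin 2) ℂ)) ∧
        ∀ y : Site (i.1.1.P i.1.2.2) (i.1.2.2 - i.1.2.1), l₀ (embIter (i.1.2.2 - i.1.2.1) y) = cf y) →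
        2 * (12 * i.1.1.L ^ (i.1.2.2 - i.1.2.1) + 5) ≤ (i.1.1.P i.1.2.2).sitesPerDir 0 →
      ∀ a' : ℝ, 0 ≤ a' → ∀ (w : Site (i.1.1.P i.1.2.2) 0 → Matrix (Fin 2) (Fin 2) ℂ) (m' : ℝ), (∀ x, ‖w x‖ ≤ m') →
        ∀ b : PBond (i.1.1.P i.1.2.2) 0,
          ‖(toL2 i.1.1 i.1.2.2 (c₀ L)).symm (DL2 i.1.1 i.1.2.1 i.1.2.2 (c₀ L) U₀ (GprimeP i.1.1 i.1.2.1 i.1.2.2 i.2.2.le (c₀ L) (cB L) a' U₀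
            (RS i.1.1 i.1.2.1 i.1.2.2 i.2.2.le (c₀ L) (cB L) U₀ (toL2S i.1.1 i.1.2.2 (c₀ L) w)))) b‖ ≤ C₂ L * m' := by
  have key : ∃ C₂ : ℕ → ℝ, (∀ (L : ℕ), 1 < L → ∀ (i : T3Thm1Carrier.Idx L) (U₀ : GaugeField (i.1.1.P i.1.2.2) 0 (Matrix.specialUnitaryGroup (Fin 2) ℂ)), ∀ ρ : ℝ, RegPr i.1.1 i.1.2.1 i.1.2.2 ρ U₀ →
        ρ ≤ min (1 / (10 ^ 12 * (L : ℝ) ^ 3)) (1 / (2 * ((exists_curved_localGradient.choose + 1) * (48 * (6 * Real.sqrt 2 * Real.sqrt 10 + 6 * Real.sqrt 2))))) →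
        (∀ cf : Site (i.1.1.P i.1.2.2) (i.1.2.2 - i.1.2.1) → Matrix (Fin 2) (Fin 2) ℂ,
        (∀ e' : PBond (i.1.1.P i.1.2.2) (i.1.2.2 - i.1.2.1), cf e'.src = ((emlIterU (i.1.2.2 - i.1.2.1) (bgUnits i.1.1 i.1.2.2 U₀) e' : (Matrix (Fin 2) (Fin 2) ℂ)ˣ) : Matrix (Fin 2) (Fin 2) ℂ) * cf e'.tgt *
        (((emlIterU (i.1.2.2 - i.1.2.1) (bgUnits i.1.1 i.1.2.2 U₀) e')⁻¹ : (Matrix (Fin 2) (Fin 2) ℂ)ˣ) : Matrix (Fin 2) (Fin 2) ℂ)) →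
        ∃ l₀ : Site (i.1.1.P i.1.2.2) 0 → Matrix (Fin 2) (Fin 2) ℂ,
        (∀ b' : PBond (i.1.1.P i.1.2.2) 0, l₀ b'.src = ((bgUnits i.1.1 i.1.2.2 U₀ b' : (Matrix (Fin 2) (Fin 2) ℂ)ˣ) : Matrix (Fin 2) (Fin 2) ℂ) * l₀ b'.tgt * (((bgUnits i.1.1 i.1.2.2 U₀ b')⁻¹ : (Matrix (Fin 2) (Fin 2) ℂ)ˣ) : Matrix (Fin 2) (Fin 2) ℂ)) ∧
        ∀ y : Site (i.1.1.P i.1.2.2) (i.1.2.2 - i.1.2.1), l₀ (embIter (i.1.2.2 - i.1.2.1) y) = cf y) →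
        2 * (12 * i.1.1.L ^ (i.1.2.2 - i.1.2.1) + 5) ≤ (i.1.1.P i.1.2.2).sitesPerDir 0 →
      ∀ a' : ℝ, 0 ≤ a' → ∀ (w : Site (i.1.1.P i.1.2.2) 0 → Matrix (Fin 2) (Fin 2) ℂ) (m' : ℝ), (∀ x, ‖w x‖ ≤ m') →
        ∀ b : PBond (i.1.1.P i.1.2.2) 0,
          ‖(toL2 i.1.1 i.1.2.2 (c₀ L)).symm (DL2 i.1.1 i.1.2.1 i.1.2.2 (c₀ L) U₀ (GprimeP i.1.1 i.1.2.1 i.1.2.2 i.2.2.le (c₀ L) (cB L) a' U₀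
            (RS i.1.1 i.1.2.1 i.1.2.2 i.2.2.le (c₀ L) (cB L) U₀ (toL2S i.1.1 i.1.2.2 (c₀ L) w)))) b‖ ≤ C₂ L * m') ∧
      (∀ L : ℕ, 1 < L → 0 ≤ C₂ L) :=
    ⟨_, fun L hL i U₀ ρ hρ hρα hLift hroom a' ha' w m' hw b =>
      norm_symm_DL2_GprimeP_RS_toL2S_le_member_of_lift i.1.1 i.2.2.le (c₀ := c₀ L) (cB := cB L) (alphaH_pos L hL) U₀ (regPr_mono i.1.1 hρα hρ) i.2.2
        (alphaH_window_member L hL i le_rfl) one_pos hLift ha' hroom (alphaH_windows L hL le_rfl).2.2 w hw b,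
      fun L hL => by
        have hCg0 : 0 ≤ exists_curved_localGradient.choose := exists_curved_localGradient.choose_spec.1
        obtain ⟨hC0, -⟩ := norm_bgOfCfg_axialT_sub_le.choose_spec
        have hα0 := (alphaH_pos L hL).le
        have hM2 : (2:ℝ) ≤ max 2 (16 / (1:ℝ)) := le_max_left _ _
        have hsM : 0 < Real.sqrt (max 2 (16 / (1:ℝ))) := Real.sqrt_pos.2 (by linarith)
        positivity⟩
  obtain ⟨C₂, hrows, h₂⟩ := key
  exact ⟨C₂, h₂, hrows⟩

/-! ## §4 ★★★ The (H∇)-FAMILY ∃-package -/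

/-- ★★★ **THE (H∇) LETTER FOR EVERY MEMBER OF EVERY FAMILY — `αH′`, `BH` ∃-PACKAGED, L-ONLY.**  For every `L > 1` there are a regularity scale
`0 < αH′ L` (inside the `10¹²L³` window; `αH′ := min αH αP`, `αP` the (Dg) package's scale) and a constant `0 ≤ BH L` such that for every member
`i = (F, n < K)` with `F.L = L`, every background `U₀` with `RegPr F n K ρ U₀`, `ρ ≤ αH′ L`, the face's Lift antecedent and HESS-T1's no-wrap room,
and every display coupling `0 ≤ a′`, the (∇1)-KNIT's chain-potential Hessian letter holds:
`∀ v m, (∀ x, ‖v x‖ ≤ m) → ‖∇^η_{(115)}(toL2⁻¹(D_{U₀}(G′ᴾ_{a′}(R_S(G′ᴾ_{a′}(toL2S v))))) ∘ bondEquiv⁻¹)‖ ≤ BH L · m`.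
PROOF: ✓`hessRow_chain_of_letters` per member at `α := αH′ L` (`RegPr ρ → RegPr (αH′ L)` by ✓`regPr_mono`; `α ≤ 1` and `hsmall` by §1), its
letters (c1)∕(c3) ⟸ §2, (Dg) ⟸ ✓`gradRow_RS_GprimeP_allMembers_exists`; `BH` = HESS-T1's closed bound in `αH′ L, C₁ L, C₃ L, C_{Dg} L`
(assembled by unification), `0 ≤ BH L` by `positivity`.
[cite: Balaban1985Variational, (19) p.281, (115)–(117) pp.294–295, (138)–(139) p.299; Balaban1985BackgroundPropagators, (3.3) p.391, (3.20)–(3.25) p.394,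
Thm 3.1 (3.42)–(3.46) pp.397–398, (3.49) p.399, (3.114)–(3.122) pp.418–420, (3.138) p.423] -/
theorem hessRow_chain_family (c₀ cB : ℕ → ℝ) [hc₀ : ∀ L : ℕ, Fact (0 < c₀ L)] [hcB : ∀ L : ℕ, Fact (0 < cB L)] :
    ∃ (αH BH : ℕ → ℝ), (∀ L : ℕ, 1 < L → 0 < αH L) ∧ (∀ L : ℕ, 1 < L → 10 ^ 12 * (L : ℝ) ^ 3 * αH L ≤ 1) ∧ (∀ L : ℕ, 1 < L → 0 ≤ BH L) ∧
      ∀ (L : ℕ), 1 < L → ∀ (i : T3Thm1Carrier.Idx L) (U₀ : GaugeField (i.1.1.P i.1.2.2) 0 (Matrix.specialUnitaryGroup (Fin 2) ℂ)), ∀ ρ : ℝ, RegPr i.1.1 i.1.2.1 i.1.2.2 ρ U₀ →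
        ρ ≤ αH L →
        (∀ cf : Site (i.1.1.P i.1.2.2) (i.1.2.2 - i.1.2.1) → Matrix (Fin 2) (Fin 2) ℂ,
        (∀ e' : PBond (i.1.1.P i.1.2.2) (i.1.2.2 - i.1.2.1), cf e'.src = ((emlIterU (i.1.2.2 - i.1.2.1) (bgUnits i.1.1 i.1.2.2 U₀) e' : (Matrix (Fin 2) (Fin 2) ℂ)ˣ) : Matrix (Fin 2) (Fin 2) ℂ) * cf e'.tgt *
        (((emlIterU (i.1.2.2 - i.1.2.1) (bgUnits i.1.1 i.1.2.2 U₀) e')⁻¹ : (Matrix (Fin 2) (Fin 2) ℂ)ˣ) : Matrix (Fin 2) (Fin 2) ℂ)) →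
        ∃ l₀ : Site (i.1.1.P i.1.2.2) 0 → Matrix (Fin 2) (Fin 2) ℂ,
        (∀ b' : PBond (i.1.1.P i.1.2.2) 0, l₀ b'.src = ((bgUnits i.1.1 i.1.2.2 U₀ b' : (Matrix (Fin 2) (Fin 2) ℂ)ˣ) : Matrix (Fin 2) (Fin 2) ℂ) * l₀ b'.tgt * (((bgUnits i.1.1 i.1.2.2 U₀ b')⁻¹ : (Matrix (Fin 2) (Fin 2) ℂ)ˣ) : Matrix (Fin 2) (Fin 2) ℂ)) ∧
        ∀ y : Site (i.1.1.P i.1.2.2) (i.1.2.2 - i.1.2.1), l₀ (embIter (i.1.2.2 - i.1.2.1) y) = cf y) →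
        2 * (12 * i.1.1.L ^ (i.1.2.2 - i.1.2.1) + 5) ≤ (i.1.1.P i.1.2.2).sitesPerDir 0 →
      ∀ a' : ℝ, 0 ≤ a' → ∀ (v : Site (i.1.1.P i.1.2.2) 0 → Matrix (Fin 2) (Fin 2) ℂ) (m : ℝ), (∀ x, ‖v x‖ ≤ m) →
        ‖nabla115 (((i.1.1.L : ℝ)⁻¹) ^ (i.1.2.2 - i.1.2.1)) (bgOfCfg i.1.1 i.1.2.2 U₀)
            (fun q : Bond 3 (periodsT3 i.1.1 i.1.2.2) => (toL2 i.1.1 i.1.2.2 (c₀ L)).symm (DL2 i.1.1 i.1.2.1 i.1.2.2 (c₀ L) U₀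
              (GprimeP i.1.1 i.1.2.1 i.1.2.2 i.2.2.le (c₀ L) (cB L) a' U₀ (RS i.1.1 i.1.2.1 i.1.2.2 i.2.2.le (c₀ L) (cB L) U₀
                (GprimeP i.1.1 i.1.2.1 i.1.2.2 i.2.2.le (c₀ L) (cB L) a' U₀ (toL2S i.1.1 i.1.2.2 (c₀ L) v))))) ((bondEquiv i.1.1 i.1.2.2).symm q))‖
          ≤ BH L * m := by
  have hCg0 : 0 ≤ exists_curved_localGradient.choose := exists_curved_localGradient.choose_spec.1
  obtain ⟨hC0, -⟩ := norm_bgOfCfg_axialT_sub_le.choose_spec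
  obtain ⟨C₁, C₃, hC₁, hC₃, hc13⟩ := hc1_hc3_sup_family c₀ cB
  obtain ⟨αP, CDg, hαP, hCDg, hDg⟩ := gradRow_RS_GprimeP_allMembers_exists c₀ cB
  -- the scale of this package: `αH′ := min αH αP`
  have hα0 : ∀ L : ℕ, 1 < L → 0 < min (min (1 / (10 ^ 12 * (L : ℝ) ^ 3)) (1 / (2 * ((exists_curved_localGradient.choose + 1) * (48 * (6 * Real.sqrt 2 * Real.sqrt 10 + 6 * Real.sqrt 2)))))) (αP L) := fun L hL => lt_min (alphaH_pos L hL) (hαP L hL)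
  have hwin : ∀ L : ℕ, 1 < L → 10 ^ 12 * (L : ℝ) ^ 3 * min (min (1 / (10 ^ 12 * (L : ℝ) ^ 3)) (1 / (2 * ((exists_curved_localGradient.choose + 1) * (48 * (6 * Real.sqrt 2 * Real.sqrt 10 + 6 * Real.sqrt 2)))))) (αP L) ≤ 1 ∧ min (min (1 / (10 ^ 12 * (L : ℝ) ^ 3)) (1 / (2 * ((exists_curved_localGradient.choose + 1) * (48 * (6 * Real.sqrt 2 * Real.sqrt 10 + 6 * Real.sqrt 2)))))) (αP L) ≤ 1 ∧
      exists_curved_localGradient.choose * ((48 * min (min (1 / (10 ^ 12 * (L : ℝ) ^ 3)) (1 / (2 * ((exists_curved_localGradient.choose + 1) * (48 * (6 * Real.sqrt 2 * Real.sqrt 10 + 6 * Real.sqrt 2)))))) (αP L)) * (6 * Real.sqrt 2 * Real.sqrt 10 + 6 * Real.sqrt 2)) ≤ 1 / 2 :=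
    fun L hL => alphaH_windows L hL (min_le_left _ _)
  -- the row FIRST (its proof assembles `BH` by unification), the sign SECOND (positivity on the assembled constant)
  have key : ∃ BH : ℕ → ℝ, (∀ (L : ℕ), 1 < L → ∀ (i : T3Thm1Carrier.Idx L) (U₀ : GaugeField (i.1.1.P i.1.2.2) 0 (Matrix.specialUnitaryGroup (Fin 2) ℂ)), ∀ ρ : ℝ, RegPr i.1.1 i.1.2.1 i.1.2.2 ρ U₀ →
        ρ ≤ min (min (1 / (10 ^ 12 * (L : ℝ) ^ 3)) (1 / (2 * ((exists_curved_localGradient.choose + 1) * (48 * (6 * Real.sqrt 2 * Real.sqrt 10 + 6 * Real.sqrt 2)))))) (αP L) →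
        (∀ cf : Site (i.1.1.P i.1.2.2) (i.1.2.2 - i.1.2.1) → Matrix (Fin 2) (Fin 2) ℂ,
        (∀ e' : PBond (i.1.1.P i.1.2.2) (i.1.2.2 - i.1.2.1), cf e'.src = ((emlIterU (i.1.2.2 - i.1.2.1) (bgUnits i.1.1 i.1.2.2 U₀) e' : (Matrix (Fin 2) (Fin 2) ℂ)ˣ) : Matrix (Fin 2) (Fin 2) ℂ) * cf e'.tgt *
        (((emlIterU (i.1.2.2 - i.1.2.1) (bgUnits i.1.1 i.1.2.2 U₀) e')⁻¹ : (Matrix (Fin 2) (Fin 2) ℂ)ˣ) : Matrix (Fin 2) (Fin 2) ℂ)) →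
        ∃ l₀ : Site (i.1.1.P i.1.2.2) 0 → Matrix (Fin 2) (Fin 2) ℂ,
        (∀ b' : PBond (i.1.1.P i.1.2.2) 0, l₀ b'.src = ((bgUnits i.1.1 i.1.2.2 U₀ b' : (Matrix (Fin 2) (Fin 2) ℂ)ˣ) : Matrix (Fin 2) (Fin 2) ℂ) * l₀ b'.tgt * (((bgUnits i.1.1 i.1.2.2 U₀ b')⁻¹ : (Matrix (Fin 2) (Fin 2) ℂ)ˣ) : Matrix (Fin 2) (Fin 2) ℂ)) ∧
        ∀ y : Site (i.1.1.P i.1.2.2) (i.1.2.2 - i.1.2.1), l₀ (embIter (i.1.2.2 - i.1.2.1) y) = cf y) →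
        2 * (12 * i.1.1.L ^ (i.1.2.2 - i.1.2.1) + 5) ≤ (i.1.1.P i.1.2.2).sitesPerDir 0 →
      ∀ a' : ℝ, 0 ≤ a' → ∀ (v : Site (i.1.1.P i.1.2.2) 0 → Matrix (Fin 2) (Fin 2) ℂ) (m : ℝ), (∀ x, ‖v x‖ ≤ m) →
        ‖nabla115 (((i.1.1.L : ℝ)⁻¹) ^ (i.1.2.2 - i.1.2.1)) (bgOfCfg i.1.1 i.1.2.2 U₀)
            (fun q : Bond 3 (periodsT3 i.1.1 i.1.2.2) => (toL2 i.1.1 i.1.2.2 (c₀ L)).symm (DL2 i.1.1 i.1.2.1 i.1.2.2 (c₀ L) U₀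
              (GprimeP i.1.1 i.1.2.1 i.1.2.2 i.2.2.le (c₀ L) (cB L) a' U₀ (RS i.1.1 i.1.2.1 i.1.2.2 i.2.2.le (c₀ L) (cB L) U₀
                (GprimeP i.1.1 i.1.2.1 i.1.2.2 i.2.2.le (c₀ L) (cB L) a' U₀ (toL2S i.1.1 i.1.2.2 (c₀ L) v))))) ((bondEquiv i.1.1 i.1.2.2).symm q))‖
          ≤ BH L * m) ∧ (∀ L : ℕ, 1 < L → 0 ≤ BH L) :=
    ⟨_, fun L hL i U₀ ρ hρ hρα hLift hroom a' ha' v m hv =>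
      hessRow_chain_of_letters i.1.1 i.2.2.le (c₀ L) (cB L) a' (hα0 L hL) (hwin L hL).2.1 U₀ (regPr_mono i.1.1 hρα hρ) ha' (hC₁ L hL) (hC₃ L hL) (hCDg L hL)
        (fun w m' hw x => (hc13 L hL i U₀ ρ hρ (hρα.trans (min_le_left _ _)) hLift a' ha' w m' hw).1 x)
        (fun w m' hw x => (hc13 L hL i U₀ ρ hρ (hρα.trans (min_le_left _ _)) hLift a' ha' w m' hw).2 x)
        (fun w m' hw b => hDg L hL i a' ha' U₀ (regPr_mono i.1.1 (hρα.trans (min_le_right _ _)) hρ) hLift w m' hw b)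
        hroom (hwin L hL).2.2 v m hv,
      fun L hL => by
        have := (hα0 L hL).le; have := hC₁ L hL; have := hC₃ L hL; have := hCDg L hL
        positivity⟩
  obtain ⟨BH, hrows, hBH⟩ := key
  exact ⟨fun L => min (min (1 / (10 ^ 12 * (L : ℝ) ^ 3)) (1 / (2 * ((exists_curved_localGradient.choose + 1) * (48 * (6 * Real.sqrt 2 * Real.sqrt 10 + 6 * Real.sqrt 2)))))) (αP L), BH, hα0, fun L hL => (hwin L hL).1, hBH, hrows⟩

end Summit.QuantumFields.YangMills.Theorems.Prop7ChainPotentialHessianFamily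

end
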